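import Summits.BirchSwinnertonDyer.BirchSwinnertonDyer.Theorems.GoldfeldAllTwistsTwoConverseTwinAdditiveTwoAdicThreeModEightPOne
import Summits.BirchSwinnertonDyer.BirchSwinnertonDyer.Theorems.GoldfeldAllTwistsTwoConverseTwinAdditiveTwoPrimesTwistSelmerDualPlusPOneAlpha
import HarnessLib

set_option linter.dupNamespace false -- namespace `…BirchSwinnertonDyer.BirchSwinnertonDyer…` is the cell's (D-0017 nested layout)
set_option autoImplicit false

/-!
# OBJECT A3⁺ tranche F-II, file F5a: `…TwinAdditiveTwoPrimesTwistSelmerDualLocalThreeModEightPOneAlpha` — the LOCAL KILLS the a31+ dual Selmer file F5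
# needs beyond C5-F's: the `2`-adic kills of the p-FREE classes `−q, 7q, −2q, 14q` of `S′ = S(84qp, −28q²p²)` on `(q, p) ≡ (3, 1) (mod 8)` and the
# `p`-adic TYPE-α kills of the classes `2p, −14p` at `p ≡ 1 (8)`

Cell `bsd-goldfeld`, seat `bsd-goldfeld-s1p-c3x` (gen 17); planner ORDER (cdvi) «A3⁺-F» tranche F-II (kill table kit j328674: 44/44 a31+ rows qp ≤ 30 000;
memo `HOME/A3PLUS-FORMULA-SCOPING.md` §1; kill-switch K-F5). §1–§2: on C5 (`(p/q) = −1`) the classes `−q, 7q, −2q, 14q` died at `p` by non-residue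
(`(q/p) = −1`); on a31+ (`(p/q) = (q/p) = +1`) they die ONLY at `2`, and they do so through C5-F's OWN numerics: after the square factor `p ↦ 1`
(`p ≡ 1 (8)`, `isSoluble_two_of_sq_factor`) and the common factor `q ↦ 3` (`q ≡ 3 (8)`) the classes `−q, 7q, −2q, 14q` are the normalised quartics
`(252; −3, 84)`, `(252; 21, −12)`, `(252; −6, 42)` (+ swap) of T0′ `…TwinAdditiveTwoAdicThreeModEightPOne` — the same numerics as its `−qp, 7qp, −2qp, 14qp`.
§3: the type-α kills at `p ≡ 1 (8)` of the classes `2p` (`e = 2`, `e′ = −14q²`) and `−14p` (`e = −14`, `e′ = 2q²`): a square root `T = X²` of the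
reduced quadratic gives the root `Z = irX` (`r² = q`, `i² = −1` mod `p`) of `Q₅ = 7Z⁴ + 42Z² − 1`, resp. `Q₆ = Z⁴ − 42Z² − 7`, root-free mod `p` in
type α by c301's `rootfree_seven_type_of_alpha` (in tree) — the pattern of a71+'s `not_isSoluble_padic_typeAlpha_class_P_plus`.
`--supports stmt-BirchSwinnertonDyer-19140` as a HELPER. Theses-free; theorems only; no definition, no fact binder, no `sorry`. FRONTIER-grade: a twist-density-ZERO
sub-family; never distance-to-summit. HONEST FRAMING: local lemmas only; no Selmer group is bounded in this file; items 19140 / 19350 / 20044 unchanged;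
BSD is not proved by any of this.

References: [SilvermanAEC2009] Prop. X.4.9, Example X.4.10; [Serre1973] Ch. II §3.3 Thm 4; [CoatesLiTianZhai2015] §5.
-/

noncomputable section

open scoped Classical

open WeierstrassCurve Literature.NumberTheory.EllipticCurves

namespace Summit.BirchSwinnertonDyer.BirchSwinnertonDyer.Theorems.GoldfeldGoodTwists

/-! ## §1 Engine: square factor `p ↦ 1`, then common factor `q ↦ 3` -/

section Classes
variable {q p : ℕ}

/-- Engine, square-then-common type for the p-FREE `q`-classes: `d = q·d₀`, `d′ = p²·q·e₀`, `a = 84qp` ⇒ after `p ↦ 1` on the `z`-side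
(`p ≡ 1 (8)`) and `q ↦ 3` (`q ≡ 3 (8)`) the class is the numeric quartic `(3·84; 3d₀, 3e₀)`. [cite: Serre1973, Ch. II §3.3 Thm 4] -/
private theorem kill_sq_common_threeOne (hq8 : q % 8 = 3) (hp8 : p % 8 = 1) {a d d' d₀ e₀ : ℤ}
    (ha : a = 84 * ((q : ℤ) * p)) (hd : d = q * d₀) (hd' : d' = (p : ℤ) ^ 2 * (q * e₀))
    (hk : ¬ ((twoIsogenyQuartic (3 * 84) (3 * d₀) (3 * e₀)).map (Int.castRingHom ℚ_[2])).IsSoluble) :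
    ¬ ((twoIsogenyQuartic a d d').map (Int.castRingHom ℚ_[2])).IsSoluble := fun h ↦ by
  have h1 := isSoluble_two_of_sq_factor (n := p) (n₀ := 1) (by omega) (a₁ := 84 * q) (e₁ := q * e₀) (by rw [ha]; ring) hd' h
  exact hk (isSoluble_two_of_common_factor (n := q) (n₀ := 3) (by omega) (a₀ := 84) (d₀ := d₀) (e₀ := e₀) (by ring) hd (by ring) h1)

/-! ## §2 The p-free classes `−q`, `7q`, `−2q`, `14q` of `S′(W)` at `(q, p) ≡ (3, 1) (mod 8)` -/

/-- **Class `−q` of `S′`** (`d′ = 28qp²`), `(q, p) ≡ (3, 1) (mod 8)`: no `ℚ₂`-point (T0′'s `(252; −3, 84)`). [cite: SilvermanAEC2009, Prop. X.4.9 and Example X.4.10] -/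
theorem not_isSoluble_two_dual_negQ_threeOne (hq8 : q % 8 = 3) (hp8 : p % 8 = 1) {a d d' : ℤ} (ha : a = 84 * ((q : ℤ) * p))
    (hd : d = -(q : ℤ)) (hd' : d' = 28 * ((q : ℤ) * p ^ 2)) :
    ¬ ((twoIsogenyQuartic a d d').map (Int.castRingHom ℚ_[2])).IsSoluble :=
  kill_sq_common_threeOne hq8 hp8 ha (d₀ := -1) (e₀ := 28) (by rw [hd]; ring) (by rw [hd']; ring)
    (by norm_num; exact not_isSoluble_two_normalised_negQP_threeOne)

/-- **Class `7q` of `S′`** (`d′ = −4qp²`), `(q, p) ≡ (3, 1) (mod 8)`: no `ℚ₂`-point (T0′'s `(252; 21, −12)`). [cite: SilvermanAEC2009, Prop. X.4.9 and Example X.4.10] -/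
theorem not_isSoluble_two_dual_sevenQ_threeOne (hq8 : q % 8 = 3) (hp8 : p % 8 = 1) {a d d' : ℤ} (ha : a = 84 * ((q : ℤ) * p))
    (hd : d = 7 * (q : ℤ)) (hd' : d' = -4 * ((q : ℤ) * p ^ 2)) :
    ¬ ((twoIsogenyQuartic a d d').map (Int.castRingHom ℚ_[2])).IsSoluble :=
  kill_sq_common_threeOne hq8 hp8 ha (d₀ := 7) (e₀ := -4) (by rw [hd]; ring) (by rw [hd']; ring)
    (by norm_num; exact not_isSoluble_two_normalised_sevenQP_threeOne)

/-- **Class `−2q` of `S′`** (`d′ = 14qp²`), `(q, p) ≡ (3, 1) (mod 8)`: no `ℚ₂`-point (T0′'s `(252; −6, 42)`). [cite: SilvermanAEC2009, Prop. X.4.9 and Example X.4.10] -/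
theorem not_isSoluble_two_dual_negTwoQ_threeOne (hq8 : q % 8 = 3) (hp8 : p % 8 = 1) {a d d' : ℤ} (ha : a = 84 * ((q : ℤ) * p))
    (hd : d = -2 * (q : ℤ)) (hd' : d' = 14 * ((q : ℤ) * p ^ 2)) :
    ¬ ((twoIsogenyQuartic a d d').map (Int.castRingHom ℚ_[2])).IsSoluble :=
  kill_sq_common_threeOne hq8 hp8 ha (d₀ := -2) (e₀ := 14) (by rw [hd]; ring) (by rw [hd']; ring)
    (by norm_num; exact not_isSoluble_two_normalised_negTwoQP_threeOne)

/-- **Class `14q` of `S′`** (`d′ = −2qp²`), `(q, p) ≡ (3, 1) (mod 8)`: no `ℚ₂`-point (the `u ↔ z` swap of the normalised `−2q` numeric).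
[cite: SilvermanAEC2009, Prop. X.4.9 and Example X.4.10] -/
theorem not_isSoluble_two_dual_fourteenQ_threeOne (hq8 : q % 8 = 3) (hp8 : p % 8 = 1) {a d d' : ℤ} (ha : a = 84 * ((q : ℤ) * p))
    (hd : d = 14 * (q : ℤ)) (hd' : d' = -2 * ((q : ℤ) * p ^ 2)) :
    ¬ ((twoIsogenyQuartic a d d').map (Int.castRingHom ℚ_[2])).IsSoluble :=
  kill_sq_common_threeOne hq8 hp8 ha (d₀ := 14) (e₀ := -2) (by rw [hd]; ring) (by rw [hd']; ring)
    (by norm_num; rw [isSoluble_map_twoIsogenyQuartic_comm]; exact not_isSoluble_two_normalised_negTwoQP_threeOne)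

end Classes

/-! ## §3 The type-α kills at `p ≡ 1 (mod 8)`: classes `2p`, `−14p` of `S′(W)` -/

section AlphaKills
variable {q p : ℕ} [Fact p.Prime]

/-- **Type-α kill at `p`, class `2p ∈ S′(W)` (a31+)**: `d = p·2`, `d′ = p·(−14q²)`; a square root `T = X²` of `−14q²T² + 84qT + 2` gives the root `Z = irX`
(`r² = q`, `i² = −1`) of `Q₅ = 7Z⁴ + 42Z² − 1`, root-free in type α at `p ≡ 1 (8)`. [cite: SilvermanAEC2009, Prop. X.4.9 and Example X.4.10] [cite: CoatesLiTianZhai2015, §5] -/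
theorem not_isSoluble_padic_typeAlpha_class_twoP_plus (hp8 : p % 8 = 1) (hα : ¬ ∃ x : ZMod p, x ^ 4 = -7)
    (hqsq : IsSquare ((q : ℤ) : ZMod p)) (him : IsSquare ((-1 : ℤ) : ZMod p)) (h2p0 : ((2 : ℤ) : ZMod p) ≠ 0)
    (h14q2 : ((-14 * (q : ℤ) ^ 2 : ℤ) : ZMod p) ≠ 0)
    {d d' : ℤ} (hd : d = p * (2 : ℤ)) (hd' : d' = p * (-14 * (q : ℤ) ^ 2)) :
    ¬ ((twoIsogenyQuartic (84 * ((q : ℤ) * p)) d d').map (Int.castRingHom ℚ_[p])).IsSoluble := by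
  refine not_isSoluble_padic_of_prime_dvd_coeffs_of_roots (p := p) (c := 84 * q) (e := (2 : ℤ)) (e' := -14 * (q : ℤ) ^ 2) (by ring) hd hd'
    h14q2 (fun T hT ↦ ?_)
  rintro ⟨X, rfl⟩
  obtain ⟨r, hr⟩ := hqsq
  obtain ⟨i, hi⟩ := him
  push_cast at hr hi hT h2p0
  have h5 := (rootfree_seven_type_of_alpha hp8 hα (i * r * X)).2.2.1
  apply h5
  have h2 : (2 : ZMod p) * (7 * (i * r * X) ^ 4 + 42 * (i * r * X) ^ 2 - 1) = 0 := by
    linear_combination (-1 : ZMod p) * hT + (-(14 * X ^ 4 * (i * i - 1) * r ^ 4 + 84 * X ^ 2 * r ^ 2)) * hi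
      + (-(14 * X ^ 4 * (r * r + (q : ZMod p)) - 84 * X ^ 2)) * hr
  exact (mul_eq_zero.mp h2).resolve_left h2p0

/-- **Type-α kill at `p`, class `−14p ∈ S′(W)` (a31+)**: `d = p·(−14)`, `d′ = p·(2q²)`; a square root `T = X²` of `2q²T² + 84qT − 14` gives the root `Z = irX`
of `Q₆ = Z⁴ − 42Z² − 7`, root-free in type α at `p ≡ 1 (8)`. [cite: SilvermanAEC2009, Prop. X.4.9 and Example X.4.10] [cite: CoatesLiTianZhai2015, §5] -/
theorem not_isSoluble_padic_typeAlpha_class_negFourteenP_plus (hp8 : p % 8 = 1) (hα : ¬ ∃ x : ZMod p, x ^ 4 = -7)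
    (hqsq : IsSquare ((q : ℤ) : ZMod p)) (him : IsSquare ((-1 : ℤ) : ZMod p)) (h2p0 : ((2 : ℤ) : ZMod p) ≠ 0)
    (h2q2 : ((2 * (q : ℤ) ^ 2 : ℤ) : ZMod p) ≠ 0)
    {d d' : ℤ} (hd : d = p * (-14 : ℤ)) (hd' : d' = p * (2 * (q : ℤ) ^ 2)) :
    ¬ ((twoIsogenyQuartic (84 * ((q : ℤ) * p)) d d').map (Int.castRingHom ℚ_[p])).IsSoluble := by
  refine not_isSoluble_padic_of_prime_dvd_coeffs_of_roots (p := p) (c := 84 * q) (e := (-14 : ℤ)) (e' := 2 * (q : ℤ) ^ 2) (by ring) hd hd'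
    h2q2 (fun T hT ↦ ?_)
  rintro ⟨X, rfl⟩
  obtain ⟨r, hr⟩ := hqsq
  obtain ⟨i, hi⟩ := him
  push_cast at hr hi hT h2p0
  have h6 := (rootfree_seven_type_of_alpha hp8 hα (i * r * X)).2.2.2
  apply h6
  have h2 : (2 : ZMod p) * ((i * r * X) ^ 4 - 42 * (i * r * X) ^ 2 - 7) = 0 := by
    linear_combination hT + (-(2 * X ^ 4 * (i * i - 1) * r ^ 4 - 84 * X ^ 2 * r ^ 2)) * hi
      + (-(2 * X ^ 4 * (r * r + (q : ZMod p)) + 84 * X ^ 2)) * hr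
  exact (mul_eq_zero.mp h2).resolve_left h2p0

end AlphaKills

end Summit.BirchSwinnertonDyer.BirchSwinnertonDyer.Theorems.GoldfeldGoodTwists

end
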